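import Literature.NumberTheory.Automorphic.BrandtModuleResidueRamified
import HarnessLib

/-!
# Residual classification V: `|Z| = p²` gives the ramified structure

Eleventh layer of the proof files for the named fact `brandtMatrix_comm` of `BrandtModule.lean`
(Vignéras, LNM 800, III §5 ex. 5.8; Eichler 1973, II §6 Thm. 2). Continuing
`BrandtModuleResidueRamified.lean` (`A = O / p O` without non-trivial idempotents, norm lattice
`𝔓`, image `Z ⊆ A`), in the case `|Z| = p²`:

* `mul_eq_zero_of_card_normResidue_sq` — **`Z · Z = 0`**: for `z, z' ∈ Z` the map `a ↦ a z z'`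
  has image inside `Z z'` (at most `p` elements, as `y ↦ y z'` kills the line `ℤ z'`), so its
  kernel has more than `p² = |Z|` elements and contains a unit; hence `𝔓² ⊆ p O`;
* `IsMaximalZOrder.smul_le_normLattice_sq` — for a **maximal** order, **`p O ⊆ 𝔓²`**: otherwise
  every `y` with `p y ∈ 𝔓²` lies in `𝔓`, so `𝔓² ⊆ p 𝔓` and **(M1)** forces `𝔓 ⊆ p O`;
* `IsMaximalZOrder.isResiduallyRamified_of_card_sq` — the conclusion `IsResiduallyRamified`
  (`𝔓` two-sided, `𝔓² = p O`, `[O : 𝔓] = p²`, `O / 𝔓` a division ring).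

## References

* M.-F. Vignéras, *Arithmétique des algèbres de quaternions*, LNM 800 (1980), Ch. II §1
  (Thm. 1.1, Lemme 1.5, Cor. 1.7: `P² = pO`, `[O : P] = p²`) [VignerasLNM800].
-/

noncomputable section

open scoped Pointwise

universe u

namespace Literature.NumberTheory.Automorphic

namespace IsZOrder

variable {B : Type u} [Ring B] [Algebra ℚ B] [IsQuaternionAlgebra ℚ B] {O : Submodule ℤ B} {p : ℕ}
  {hO : IsZOrder O} {hH : ∀ x : hO.subring, (p : ℤ) ∣ nrdZ (x : B) → (p : ℤ) ∣ trdZ (x : B)}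

/-! ### `Z` is anti-commutative -/

/-- **Anti-commutation in `Z`**: `z z' + z' z = 0` (expand `(z + z')² = 0`). [folklore] -/
theorem mul_add_mul_swap_of_mem_normResidue (hp : p.Prime) {z z' : hO.Residue p}
    (hz : z ∈ hO.normResidue p hH) (hz' : z' ∈ hO.normResidue p hH) : z * z' + z' * z = 0 := by
  have h := mul_self_of_mem_normResidue hp ((hO.normResidue p hH).add_mem hz hz')
  rw [add_mul, mul_add, mul_add, mul_self_of_mem_normResidue hp hz,
    mul_self_of_mem_normResidue hp hz', zero_add, add_zero] at h
  exact h

/-- `z w z' `-type vanishing: `z' (z z') = 0` and `(z z') z = 0`-style identities follow; we record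
`(k • z') z' = 0`. [folklore] -/
theorem intCast_mul_mul_self_of_mem_normResidue (hp : p.Prime) {z' : hO.Residue p}
    (hz' : z' ∈ hO.normResidue p hH) (k : ℤ) : (k : hO.Residue p) * z' * z' = 0 := by
  rw [mul_assoc, mul_self_of_mem_normResidue hp hz', mul_zero]

/-! ### `|Z| = p²` forces `Z · Z = 0` -/

/-- For `z' ∈ Z`, `z' ≠ 0`, the image `Z z'` of `y ↦ y z'` on `Z` has at most `|Z| / p` elements
(its kernel contains the line `ℤ z'` of order `p`). [folklore] -/
theorem card_range_mulRight_le (hp : p.Prime) {z' : hO.Residue p} (hz' : z' ∈ hO.normResidue p hH)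
    (hz'0 : z' ≠ 0) :
    Nat.card ((AddMonoidHom.mulRight z').comp (hO.normResidue p hH).subtype).range * p ≤
      Nat.card (hO.normResidue p hH) := by
  haveI : Fact p.Prime := ⟨hp⟩
  haveI := hO.finite_residue hp.ne_zero
  set Z := hO.normResidue p hH
  set ψ := (AddMonoidHom.mulRight z').comp Z.subtype
  -- the line through `z'` inside `Z` lies in the kernel
  have hline : AddSubgroup.zmultiples (⟨z', hz'⟩ : Z) ≤ ψ.ker := by
    rw [AddSubgroup.zmultiples_le]
    change ψ ⟨z', hz'⟩ = 0
    simp only [ψ, AddMonoidHom.coe_comp, Function.comp_apply, AddSubgroup.coe_subtype,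
      AddMonoidHom.coe_mulRight]
    exact mul_self_of_mem_normResidue hp hz'
  have hord : addOrderOf (⟨z', hz'⟩ : Z) = p := by
    rw [AddSubgroup.addOrderOf_mk]
    exact addOrderOf_eq_prime (by rw [nsmul_eq_mul, natCast_self_residue, zero_mul]) hz'0
  have hker : p ≤ Nat.card ψ.ker := by
    have := AddSubgroup.card_le_of_le hline
    rwa [Nat.card_zmultiples, hord] at this
  calc Nat.card ψ.range * p ≤ Nat.card ψ.range * Nat.card ψ.ker := Nat.mul_le_mul_left _ hker
    _ = Nat.card Z := by rw [mul_comm, ← AddSubgroup.index_ker, AddSubgroup.card_mul_index]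

/-- **`|Z| = p²` forces `Z · Z = 0`.** For `z, z' ∈ Z` put `w = z z'`; the map `a ↦ a w` on `A`
has image in `Z z'` (as `a z ∈ Z`), of order `≤ p`, so its kernel has `≥ p³ > |Z|` elements and
contains some `a ∉ Z`, a unit: `w = a⁻¹ (a w) = 0`. [folklore] -/
theorem mul_eq_zero_of_card_normResidue_sq (hp : p.Prime) (hcard : Nat.card (hO.normResidue p hH) = p ^ 2)
    {z z' : hO.Residue p} (hz : z ∈ hO.normResidue p hH) (hz' : z' ∈ hO.normResidue p hH) :
    z * z' = 0 := by
  classical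
  haveI : Fact p.Prime := ⟨hp⟩
  haveI := hO.finite_residue hp.ne_zero
  by_cases hz'0 : z' = 0
  · rw [hz'0, mul_zero]
  set Z := hO.normResidue p hH
  set ψ := (AddMonoidHom.mulRight z').comp Z.subtype
  set φ : hO.Residue p →+ hO.Residue p := AddMonoidHom.mulRight (z * z')
  -- `φ.range ≤ ψ.range`
  have hrange : φ.range ≤ ψ.range := by
    rintro _ ⟨a, rfl⟩
    refine ⟨⟨a * z, (mul_mem_normResidue a hz).1⟩, ?_⟩
    simp only [ψ, φ, AddMonoidHom.coe_comp, Function.comp_apply, AddSubgroup.coe_subtype,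
      AddMonoidHom.coe_mulRight, mul_assoc]
  have hψ := card_range_mulRight_le hp hz' hz'0
  have hφrange : Nat.card φ.range * p ≤ p ^ 2 := by
    rw [← hcard]
    exact (Nat.mul_le_mul_right _ (AddSubgroup.card_le_of_le hrange)).trans hψ
  -- so `|ker φ| ≥ p³`
  have hker : p ^ 3 ≤ Nat.card φ.ker := by
    have h1 : Nat.card φ.ker * Nat.card φ.range = p ^ 4 := by
      rw [← AddSubgroup.index_ker, AddSubgroup.card_mul_index, hO.card_residue hp.ne_zero]
    have hpos : 0 < Nat.card φ.range := Nat.card_pos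
    by_contra hlt
    push Not at hlt
    have : Nat.card φ.ker * Nat.card φ.range * p < p ^ 3 * p ^ 2 := by
      calc Nat.card φ.ker * Nat.card φ.range * p = Nat.card φ.ker * (Nat.card φ.range * p) := by ring
        _ ≤ Nat.card φ.ker * p ^ 2 := Nat.mul_le_mul_left _ hφrange
        _ < p ^ 3 * p ^ 2 := Nat.mul_lt_mul_of_pos_right hlt (pow_pos hp.pos 2)
    rw [h1] at this
    have : p ^ 5 < p ^ 5 := by
      calc p ^ 5 = p ^ 4 * p := by ring
        _ < p ^ 3 * p ^ 2 := this
        _ = p ^ 5 := by ring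
    exact lt_irrefl _ this
  -- the kernel is not inside `Z`
  have hnot : ¬ φ.ker ≤ Z := fun hle => by
    have := AddSubgroup.card_le_of_le hle
    rw [hcard] at this
    have : p ^ 3 ≤ p ^ 2 := hker.trans this
    exact absurd this (not_le.mpr (Nat.pow_lt_pow_right hp.one_lt (by norm_num)))
  obtain ⟨a, ha, haZ⟩ := Set.not_subset.mp hnot
  have ha' : a * (z * z') = 0 := ha
  obtain ⟨u, hu⟩ := (isUnit_of_not_mem_normResidue hp haZ).exists_left_inv
  calc z * z' = u * a * (z * z') := by rw [hu, one_mul]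
    _ = 0 := by rw [mul_assoc, ha', mul_zero]

/-- Hence **`𝔓 · 𝔓 ⊆ p O`** when `|Z| = p²`. [folklore] -/
theorem normLattice_mul_le_smul (hp : p.Prime) (hcard : Nat.card (hO.normResidue p hH) = p ^ 2) :
    hO.normLattice p hH * hO.normLattice p hH ≤ (p : ℤ) • O := by
  rw [Submodule.mul_le]
  intro x hx y hy
  have hxO : x ∈ O := normLattice_le hx
  have hyO : y ∈ O := normLattice_le hy
  have hx' : hO.res p ⟨x, hxO⟩ ∈ hO.normResidue p hH := res_mem_normResidue_iff.mpr hx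
  have hy' : hO.res p ⟨y, hyO⟩ ∈ hO.normResidue p hH := res_mem_normResidue_iff.mpr hy
  have h := mul_eq_zero_of_card_normResidue_sq hp hcard hx' hy'
  rw [← map_mul] at h
  simpa using res_eq_zero_iff.mp h

/-! ### Maximal orders: `𝔓² = p O` -/

/-- `p · 1 ∈ 𝔓` (`n(p) = p²`). [folklore] -/
theorem natCast_smul_one_mem_normLattice : (p : ℤ) • (1 : B) ∈ hO.normLattice p hH :=
  ⟨O.smul_mem _ hO.one_mem, by
    rw [hO.nrdZ_zsmul _ hO.one_mem, nrdZ_one, mul_one, pow_two]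
    exact dvd_mul_right _ _⟩

/-- `O 𝔓² ⊆ 𝔓²` and `𝔓² O ⊆ 𝔓²`. [folklore] -/
theorem mul_mem_normLattice_sq {x y : B} (hx : x ∈ O)
    (hy : y ∈ hO.normLattice p hH * hO.normLattice p hH) :
    x * y ∈ hO.normLattice p hH * hO.normLattice p hH ∧
      y * x ∈ hO.normLattice p hH * hO.normLattice p hH := by
  refine Submodule.mul_induction_on hy (fun a ha b hb => ⟨?_, ?_⟩) (fun a b ha hb => ⟨?_, ?_⟩)
  · rw [← mul_assoc]; exact Submodule.mul_mem_mul (mul_mem_normLattice hx ha).1 hb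
  · rw [mul_assoc]; exact Submodule.mul_mem_mul ha (mul_mem_normLattice hx hb).2
  · rw [mul_add]; exact Submodule.add_mem _ ha.1 hb.1
  · rw [add_mul]; exact Submodule.add_mem _ ha.2 hb.2

/-- `p 𝔓 ⊆ 𝔓²` and `p² O ⊆ 𝔓²`. [folklore] -/
theorem smul_normLattice_le_sq :
    (p : ℤ) • hO.normLattice p hH ≤ hO.normLattice p hH * hO.normLattice p hH := fun x hx => by
  obtain ⟨y, hy, rfl⟩ := (Submodule.mem_smul_pointwise_iff_exists _ _ _).mp hx
  have : (p : ℤ) • y = ((p : ℤ) • (1 : B)) * y := by rw [smul_mul_assoc, one_mul]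
  rw [this]
  exact Submodule.mul_mem_mul natCast_smul_one_mem_normLattice hy

/-- **For a maximal order with `|Z| = p²`, `p O ⊆ 𝔓²`.** Let `M = {y ∈ O | p y ∈ 𝔓²}` (a left
ideal containing `𝔓`). If some `y ∈ M ∖ 𝔓`, it is invertible mod `p`: `p · 1 = p y w − p (y w − 1)
∈ 𝔓² O + p² O ⊆ 𝔓²`. Otherwise `𝔓² ⊆ p O` (previous lemma) refines to `𝔓² ⊆ p 𝔓`, and (M1)
(`IsMaximalZOrder.mem_smul_of_mul_le` with `𝔄 = 𝔓`) puts `𝔓 ⊆ p O`, contradicting `|Z| > 1`.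
[cite: VignerasLNM800, Ch. II §1 Thm. 1.1, Lemme 1.5 (`P² = pO`)] -/
theorem _root_.Literature.NumberTheory.Automorphic.IsMaximalZOrder.smul_le_normLattice_sq
    {hO : IsZOrder O} {hH : ∀ x : hO.subring, (p : ℤ) ∣ nrdZ (x : B) → (p : ℤ) ∣ trdZ (x : B)}
    (hmax : IsMaximalZOrder O) (hp : p.Prime) (hcard : Nat.card (hO.normResidue p hH) = p ^ 2) :
    (p : ℤ) • O ≤ hO.normLattice p hH * hO.normLattice p hH := by
  haveI : IsAddTorsionFree B := isAddTorsionFree_of_charZero_module ℚ B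
  have hpZ : (p : ℤ) ≠ 0 := by exact_mod_cast hp.ne_zero
  set P := hO.normLattice p hH
  by_cases hM : ∃ y ∈ O, (p : ℤ) • y ∈ P * P ∧ y ∉ P
  · obtain ⟨y, hyO, hpy, hyP⟩ := hM
    obtain ⟨w, hw, hyw, -⟩ := exists_inv_mod_of_not_mem_normLattice hp hyO hyP
    -- `p · 1 ∈ 𝔓²`
    have hp1 : (p : ℤ) • (1 : B) ∈ P * P := by
      have : (p : ℤ) • (1 : B) = ((p : ℤ) • y) * w - (p : ℤ) • (y * w - 1) := by
        rw [smul_mul_assoc, ← smul_sub, sub_sub_cancel]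
      rw [this]
      refine Submodule.sub_mem _ (mul_mem_normLattice_sq hw hpy).2 ?_
      obtain ⟨c, hc, hcc⟩ := (Submodule.mem_smul_pointwise_iff_exists _ _ O).mp hyw
      rw [← hcc]
      exact smul_normLattice_le_sq (Submodule.smul_mem_pointwise_smul _ _ _ (smul_le_normLattice
        (Submodule.smul_mem_pointwise_smul _ _ O hc)))
    intro x hx
    obtain ⟨o, ho, rfl⟩ := (Submodule.mem_smul_pointwise_iff_exists _ _ O).mp hx
    have : (p : ℤ) • o = ((p : ℤ) • (1 : B)) * o := by rw [smul_mul_assoc, one_mul]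
    rw [this]
    exact (mul_mem_normLattice_sq ho hp1).2
  · exfalso
    push Not at hM
    -- `𝔓² ⊆ p 𝔓`
    have hsq : P * P ≤ (p : ℤ) • P := fun x hx => by
      obtain ⟨o, ho, rfl⟩ := (Submodule.mem_smul_pointwise_iff_exists _ _ O).mp
        (normLattice_mul_le_smul hp hcard hx)
      exact Submodule.smul_mem_pointwise_smul _ _ _ (hM o ho hx)
    -- (M1): every `y ∈ 𝔓` lies in `p O`
    have hPle : P ≤ (p : ℤ) • O := fun y hy =>
      hmax.mem_smul_of_mul_le hpZ smul_le_normLattice normLattice_le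
        (fun x hx a ha => (mul_mem_normLattice hx ha).1) hpZ
        fun a ha => hsq (Submodule.mul_mem_mul hy ha)
    -- but `Z ≠ 0`
    obtain ⟨x, hx0, hdvd⟩ := hO.exists_res_ne_zero_dvd_nrdZ hp
    exact hx0 (res_eq_zero_iff.mpr (hPle ⟨x.2, hdvd⟩))

/-- `[O : 𝔓] = p²` when `|Z| = p²`. [folklore] -/
theorem relIndex_normLattice_of_card_sq (hp : p.Prime) (hcard : Nat.card (hO.normResidue p hH) = p ^ 2) :
    (hO.normLattice p hH).toAddSubgroup.relIndex O.toAddSubgroup = p ^ 2 := by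
  have h := card_normResidue_mul_relIndex (hO := hO) (hH := hH) hp
  rw [hcard, show p ^ 4 = p ^ 2 * p ^ 2 by ring] at h
  exact Nat.eq_of_mul_eq_mul_left (pow_pos hp.pos 2) h

/-- **`|Z| = p²` for a maximal order gives the ramified residual structure**, witnessed by the
norm lattice `𝔓`. [cite: VignerasLNM800, Ch. II §1 Thm. 1.1, Lemme 1.5, Cor. 1.7] -/
theorem _root_.Literature.NumberTheory.Automorphic.IsMaximalZOrder.isResiduallyRamified_of_card_sq
    {hO : IsZOrder O} {hH : ∀ x : hO.subring, (p : ℤ) ∣ nrdZ (x : B) → (p : ℤ) ∣ trdZ (x : B)}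
    (hmax : IsMaximalZOrder O) (hp : p.Prime) (hcard : Nat.card (hO.normResidue p hH) = p ^ 2) :
    hO.IsResiduallyRamified p := by
  set P := hO.normLattice p hH
  refine ⟨P, smul_le_normLattice, normLattice_le, ?_, ?_, ?_, relIndex_normLattice_of_card_sq hp hcard, ?_⟩
  · rw [Submodule.mul_le]
    exact fun x hx a ha => (mul_mem_normLattice hx ha).1
  · rw [Submodule.mul_le]
    exact fun a ha x hx => (mul_mem_normLattice hx ha).2
  · exact le_antisymm (normLattice_mul_le_smul hp hcard) (hmax.smul_le_normLattice_sq hp hcard)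
  · intro x hx hxP
    obtain ⟨w, hw, h1, h2⟩ := exists_inv_mod_of_not_mem_normLattice hp hx hxP
    exact ⟨w, hw, smul_le_normLattice h1, smul_le_normLattice h2⟩

end IsZOrder

end Literature.NumberTheory.Automorphic

end
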